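import Mathlib
import HarnessLib
import Literature.NumberTheory.Automorphic.BaseChangeStrongAllFinite
import Literature.NumberTheory.Automorphic.BaseChangeStrongAllFiniteRamifiedPlaces
import Literature.NumberTheory.Automorphic.BaseChangeStrongUnramified
import Literature.NumberTheory.Automorphic.BaseChangeStrongUnramifiedOffS

/-!
# `StrongLiftingAllFinite` (item stmt-Langlands-15194 of route `SkinnerWilesDefectOne`):
# the residue decomposition — unramified clause (named leaves of the tree) + ramified clause

The item is, verbatim, the named fact
`Literature.NumberTheory.Automorphic.ArthurClozel1989_strongLifting_allFinite` (Arthur–Clozel 1989,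
Ch. 3, Thm. 5.1 read at ALL finite places, datum model): for `E/F` Galois of prime degree and
cuspidal `π`, `P` on `GL_n(𝔸_F)`, `GL_n(𝔸_E)` with `P` a weak base-change lift of `π`, at EVERY
finite `w ∣ v` at which `π` has a Satake parameter `α`, `P` has the Satake parameter `α^{f(w|v)}`.

Nothing in the tree proves it for `n ≥ 2` (no local representation theory of `GL_n(F_v)` at the
places ramified in `E/F`, no twisted trace formula).  This file records, kernel-checked, the exact
shape of what is missing, splitting the fact along `Algebra.IsUnramifiedIn (𝓞 E) v`:

* `strongLiftingAllFinite_iff_unramifiedLift_and_ramified` — the fact is EQUIVALENT to the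
  conjunction of (U) its clause at the places of `F` unramified in `E` (= clause (i) of the sibling
  `ArthurClozel1989_strongLifting_unramified`, the predicate `IsUnramifiedBaseChangeLift`) and
  (R) the RAMIFIED CLAUSE: at a place `v` of `F` ramified in `E` (there `f(w|v) = 1`, the degree
  being prime — `HeightOneSpectrum.inertiaDeg_eq_one_of_not_isUnramifiedIn`, proved) the lift has
  the SAME Satake parameter, `t_{P,w} = t_{π,v}`.
* `strongLiftingAllFinite_of_offS_of_ramified` — since (U) is already reduced in the tree to five
  NAMED leaves (`ArthurClozel1989_strongLifting_unramified_of_offS`: the `S`-threaded Thm. 4.2 (a),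
  (d), multiplicity one on `L²_cusp(GL_n)`, Jacquet–Shalika (2.2), (2.3)), the item follows from
  those five leaves and (R) alone.  So the RESIDUE of the item in the tree's present state is
  `{weakLifting_offS, cuspidal_descent_offS, multiplicity_one_gl, JS (2.2), JS (2.3)} ∪ {(R)}`, and
  (R) — Thm. 5.1 at the finitely many places ramified in `E/F`, where Arthur–Clozel's printed proof
  (pp. 212–214) uses the full twisted trace identity at `v` and the local lifting of Ch. 1 §6 along
  the totally ramified `E_w/F_v` — is the only part with no named leaf.
* `strongLiftingAllFinite_item_of_unramifiedLift_of_ramified` — the same with the conclusion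
  written as the item's literal signature (`IsWeakBaseChangeLiftAE` unfolded), for the day the route
  decl `StrongLiftingAllFinite` is linked.

All theorems here are pure logic over accepted declarations; the conditional ones take (U)/(R) or
the named leaves as hypotheses (no new definition, no new named fact).

## References

* J. Arthur, L. Clozel, *Simple algebras, base change, and the advanced theory of the trace
  formula*, Ann. of Math. Stud. 120 (1989), Ch. 3: §1 (1.1), Def. 1.1–1.2, Thm. 4.2 (a), (d) and
  their proof (pp. 203–207), Thm. 5.1 and its proof (pp. 212–214); Ch. 1 §6. [ArthurClozelAMS120]
* H. Jacquet, J. Shalika, Amer. J. Math. 103 (1981), §2 (2.2)–(2.3), Thm. 4.4. [JacquetShalika1981]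
-/

set_option linter.dupNamespace false -- project-wide option (lakefile weak.linter.dupNamespace); `Summit.Langlands.Langlands` is the mandated namespace

open scoped NumberField
open NumberField IsDedekindDomain MeasureTheory
open Literature.NumberTheory.Automorphic

namespace Summit.Langlands.Langlands.Theorems.SkinnerWilesDefectOne

/-- **The all-finite-places strong lifting from its two halves.**  If (U) every weak base-change
lift between cuspidal data over a Galois extension of prime degree is an unramified strong lift
(`IsUnramifiedBaseChangeLift`: the relation (1.1) at every finite `w ∣ v` with `v` unramified in
`E` and `π_v` unramified — clause (i) of `ArthurClozel1989_strongLifting_unramified`) and (R) at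
every finite `w ∣ v` with `v` RAMIFIED in `E` and `π_v` unramified the lift has the same Satake
parameter (`t_{P,w} = t_{π,v}`), then `ArthurClozel1989_strongLifting_allFinite` holds: split on
`Algebra.IsUnramifiedIn (𝓞 E) v`; in the ramified case `f(w|v) = 1`
(`HeightOneSpectrum.inertiaDeg_eq_one_of_not_isUnramifiedIn`), so `α^{f(w|v)} = α`.
[cite: ArthurClozelAMS120, Ch. 3 Thm. 5.1 with §1 (1.1) and Def. 1.2] -/
theorem strongLiftingAllFinite_of_unramifiedLift_of_ramified
    (hU : ∀ (n : ℕ) (F E : Type) [Field F] [NumberField F] [Field E] [NumberField E] [Algebra F E]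
      [IsGalois F E], (Module.finrank F E).Prime →
      ∀ (hF : isCompact_glFiniteIntegralLevel n F) (hE : isCompact_glFiniteIntegralLevel n E)
        (π : CuspidalAutomorphicRepData n F hF) (P : CuspidalAutomorphicRepData n E hE),
        IsWeakBaseChangeLiftAE π.1 P.1 → IsUnramifiedBaseChangeLift π.1 P.1)
    (hR : ∀ (n : ℕ) (F E : Type) [Field F] [NumberField F] [Field E] [NumberField E] [Algebra F E]
      [IsGalois F E], (Module.finrank F E).Prime →
      ∀ (hF : isCompact_glFiniteIntegralLevel n F) (hE : isCompact_glFiniteIntegralLevel n E)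
        (π : CuspidalAutomorphicRepData n F hF) (P : CuspidalAutomorphicRepData n E hE),
        IsWeakBaseChangeLiftAE π.1 P.1 →
          ∀ (w : HeightOneSpectrum (𝓞 E)) (v : HeightOneSpectrum (𝓞 F)) (α : Multiset ℂ),
            w.asIdeal.under (𝓞 F) = v.asIdeal → ¬ Algebra.IsUnramifiedIn (𝓞 E) v.asIdeal →
              π.1.HasSatakeParamAt v α → P.1.HasSatakeParamAt w α) :
    ArthurClozel1989_strongLifting_allFinite := by
  intro n F E _ _ _ _ _ _ hl hF hE π P hw w v α hwv hα
  by_cases hv : Algebra.IsUnramifiedIn (𝓞 E) v.asIdeal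
  · exact hU n F E hl hF hE π P hw w v α hwv hv hα
  · have h1 : P.1.HasSatakeParamAt w α := hR n F E hl hF hE π P hw w v α hwv hv hα
    rw [HeightOneSpectrum.inertiaDeg_eq_one_of_not_isUnramifiedIn hl hwv hv]
    simpa only [pow_one, Multiset.map_id'] using h1

/-- **The residue decomposition is exact**: `ArthurClozel1989_strongLifting_allFinite` is
EQUIVALENT to the conjunction of (U) (the unramified strong lift predicate for every weak-lift pair
of cuspidal data in prime degree) and (R) (the same Satake parameter at the places ramified in
`E/F`).  Forward: the projections `….isUnramifiedBaseChangeLift` and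
`….hasSatakeParamAt_of_not_isUnramifiedIn` of `BaseChangeStrongAllFinite`; backward:
`strongLiftingAllFinite_of_unramifiedLift_of_ramified`.
[cite: ArthurClozelAMS120, Ch. 3 Thm. 5.1 with §1 (1.1) and Def. 1.2] -/
theorem strongLiftingAllFinite_iff_unramifiedLift_and_ramified :
    ArthurClozel1989_strongLifting_allFinite ↔
      (∀ (n : ℕ) (F E : Type) [Field F] [NumberField F] [Field E] [NumberField E] [Algebra F E]
        [IsGalois F E], (Module.finrank F E).Prime →
        ∀ (hF : isCompact_glFiniteIntegralLevel n F) (hE : isCompact_glFiniteIntegralLevel n E)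
          (π : CuspidalAutomorphicRepData n F hF) (P : CuspidalAutomorphicRepData n E hE),
          IsWeakBaseChangeLiftAE π.1 P.1 → IsUnramifiedBaseChangeLift π.1 P.1) ∧
      (∀ (n : ℕ) (F E : Type) [Field F] [NumberField F] [Field E] [NumberField E] [Algebra F E]
        [IsGalois F E], (Module.finrank F E).Prime →
        ∀ (hF : isCompact_glFiniteIntegralLevel n F) (hE : isCompact_glFiniteIntegralLevel n E)
          (π : CuspidalAutomorphicRepData n F hF) (P : CuspidalAutomorphicRepData n E hE),
          IsWeakBaseChangeLiftAE π.1 P.1 →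
            ∀ (w : HeightOneSpectrum (𝓞 E)) (v : HeightOneSpectrum (𝓞 F)) (α : Multiset ℂ),
              w.asIdeal.under (𝓞 F) = v.asIdeal → ¬ Algebra.IsUnramifiedIn (𝓞 E) v.asIdeal →
                π.1.HasSatakeParamAt v α → P.1.HasSatakeParamAt w α) := by
  constructor
  · intro h
    exact ⟨fun n F E _ _ _ _ _ _ hl hF hE π P hw =>
        ArthurClozel1989_strongLifting_allFinite.isUnramifiedBaseChangeLift h hl hw,
      fun n F E _ _ _ _ _ _ hl hF hE π P hw w v α hwv hv hα =>
        ArthurClozel1989_strongLifting_allFinite.hasSatakeParamAt_of_not_isUnramifiedIn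
          h hl hw hwv hv hα⟩
  · rintro ⟨hU, hR⟩
    exact strongLiftingAllFinite_of_unramifiedLift_of_ramified hU hR

/-- **(U) from the sibling named fact**: clause (i) of `ArthurClozel1989_strongLifting_unramified`
(Thm. 5.1 at the places unramified in `E/F`) is exactly hypothesis (U).
[cite: ArthurClozelAMS120, Ch. 3 Thm. 5.1 with §1 (1.1)] -/
theorem unramifiedLift_of_strongLifting_unramified
    (h : ArthurClozel1989_strongLifting_unramified) :
    ∀ (n : ℕ) (F E : Type) [Field F] [NumberField F] [Field E] [NumberField E] [Algebra F E]
      [IsGalois F E], (Module.finrank F E).Prime →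
      ∀ (hF : isCompact_glFiniteIntegralLevel n F) (hE : isCompact_glFiniteIntegralLevel n E)
        (π : CuspidalAutomorphicRepData n F hF) (P : CuspidalAutomorphicRepData n E hE),
        IsWeakBaseChangeLiftAE π.1 P.1 → IsUnramifiedBaseChangeLift π.1 P.1 :=
  fun _ _ _ _ _ _ _ _ _ hl _ _ _ _ hw => h.isUnramifiedBaseChangeLift hl hw

/-- **The item from the sibling fact at the unramified places and the ramified clause (R).**
[cite: ArthurClozelAMS120, Ch. 3 Thm. 5.1 with §1 (1.1) and Def. 1.2] -/
theorem strongLiftingAllFinite_of_strongLifting_unramified_of_ramified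
    (h : ArthurClozel1989_strongLifting_unramified)
    (hR : ∀ (n : ℕ) (F E : Type) [Field F] [NumberField F] [Field E] [NumberField E] [Algebra F E]
      [IsGalois F E], (Module.finrank F E).Prime →
      ∀ (hF : isCompact_glFiniteIntegralLevel n F) (hE : isCompact_glFiniteIntegralLevel n E)
        (π : CuspidalAutomorphicRepData n F hF) (P : CuspidalAutomorphicRepData n E hE),
        IsWeakBaseChangeLiftAE π.1 P.1 →
          ∀ (w : HeightOneSpectrum (𝓞 E)) (v : HeightOneSpectrum (𝓞 F)) (α : Multiset ℂ),
            w.asIdeal.under (𝓞 F) = v.asIdeal → ¬ Algebra.IsUnramifiedIn (𝓞 E) v.asIdeal →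
              π.1.HasSatakeParamAt v α → P.1.HasSatakeParamAt w α) :
    ArthurClozel1989_strongLifting_allFinite :=
  strongLiftingAllFinite_of_unramifiedLift_of_ramified (unramifiedLift_of_strongLifting_unramified h) hR

/-- **The item from NAMED LEAVES of the tree plus the ramified clause (R)** — the exact residue.
Hypotheses `ha`, `hd`, `hm1`, `h22c`, `h23` are verbatim those of
`ArthurClozel1989_strongLifting_unramified_of_offS` (`BaseChangeStrongUnramifiedOffS`): the
`S`-threaded Thm. 4.2 (a) and (d) (`ArthurClozel1989_weakLifting_cuspidal_offS`,
`ArthurClozel1989_cuspidal_descent_offS`), multiplicity one on `L²_cusp(GL_n)`, and Jacquet–Shalika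
(2.2), (2.3); they give (U).  With (R) — Thm. 5.1 at the places ramified in `E/F`, the only part
of the item with no named leaf in the tree — `strongLiftingAllFinite_of_unramifiedLift_of_ramified`
concludes.
[cite: ArthurClozelAMS120, Ch. 3 Thm. 4.2 (a), (d) and their proof (pp. 203–207), Thm. 5.1 (pp. 212–214)]
[cite: JacquetShalika1981, §2 (2.2)–(2.3)] -/
theorem strongLiftingAllFinite_of_offS_of_ramified
    (ha : ∀ (n : ℕ) (F E : Type) [Field F] [NumberField F] [Field E] [NumberField E]
      [Algebra F E], ArthurClozel1989_weakLifting_cuspidal_offS n F E)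
    (hd : ∀ (n : ℕ) (F E : Type) [Field F] [NumberField F] [Field E] [NumberField E]
      [Algebra F E], ArthurClozel1989_cuspidal_descent_offS n F E)
    (hm1 : ∀ (n : ℕ) (K : Type) [Field K] [NumberField K]
      (μ : Measure (AdelicGroupData.gl n K).automorphicQuotient)
      [(AdelicGroupData.gl n K).IsAutomorphicMeasure μ], multiplicity_one_gl n K μ)
    (h22c : ∀ (n : ℕ) (K : Type) [Field K] [NumberField K]
      (μ : Measure (AdelicGroupData.gl n K).automorphicQuotient)
      [(AdelicGroupData.gl n K).IsAutomorphicMeasure μ],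
      JacquetShalika1981_partialPairL_at_one_of_ne_conj (n := n) (K := K) (μ := μ))
    (h23 : ∀ (n : ℕ) (K : Type) [Field K] [NumberField K]
      (μ : Measure (AdelicGroupData.gl n K).automorphicQuotient)
      [(AdelicGroupData.gl n K).IsAutomorphicMeasure μ],
      JacquetShalika1981_partialPairL_pole_of_eq_conj (n := n) (K := K) (μ := μ))
    (hR : ∀ (n : ℕ) (F E : Type) [Field F] [NumberField F] [Field E] [NumberField E] [Algebra F E]
      [IsGalois F E], (Module.finrank F E).Prime →
      ∀ (hF : isCompact_glFiniteIntegralLevel n F) (hE : isCompact_glFiniteIntegralLevel n E)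
        (π : CuspidalAutomorphicRepData n F hF) (P : CuspidalAutomorphicRepData n E hE),
        IsWeakBaseChangeLiftAE π.1 P.1 →
          ∀ (w : HeightOneSpectrum (𝓞 E)) (v : HeightOneSpectrum (𝓞 F)) (α : Multiset ℂ),
            w.asIdeal.under (𝓞 F) = v.asIdeal → ¬ Algebra.IsUnramifiedIn (𝓞 E) v.asIdeal →
              π.1.HasSatakeParamAt v α → P.1.HasSatakeParamAt w α) :
    ArthurClozel1989_strongLifting_allFinite :=
  strongLiftingAllFinite_of_strongLifting_unramified_of_ramified
    (ArthurClozel1989_strongLifting_unramified_of_offS ha hd hm1 h22c h23) hR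

/-- **The item's literal signature** (the route statement `StrongLiftingAllFinite` of item
stmt-Langlands-15194, `IsWeakBaseChangeLiftAE` unfolded — definitionally the named fact
`ArthurClozel1989_strongLifting_allFinite`, cf. `ArthurClozel1989_strongLifting_allFinite_iff`)
from (U) and (R).  CONDITIONAL: (U) is the unramified-places clause (named leaves, see
`strongLiftingAllFinite_of_offS_of_ramified`), (R) the ramified clause.
[cite: ArthurClozelAMS120, Ch. 3 Thm. 5.1 with §1 (1.1) and Def. 1.1–1.2] -/
theorem strongLiftingAllFinite_item_of_unramifiedLift_of_ramified
    (hU : ∀ (n : ℕ) (F E : Type) [Field F] [NumberField F] [Field E] [NumberField E] [Algebra F E]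
      [IsGalois F E], (Module.finrank F E).Prime →
      ∀ (hF : isCompact_glFiniteIntegralLevel n F) (hE : isCompact_glFiniteIntegralLevel n E)
        (π : CuspidalAutomorphicRepData n F hF) (P : CuspidalAutomorphicRepData n E hE),
        IsWeakBaseChangeLiftAE π.1 P.1 → IsUnramifiedBaseChangeLift π.1 P.1)
    (hR : ∀ (n : ℕ) (F E : Type) [Field F] [NumberField F] [Field E] [NumberField E] [Algebra F E]
      [IsGalois F E], (Module.finrank F E).Prime →
      ∀ (hF : isCompact_glFiniteIntegralLevel n F) (hE : isCompact_glFiniteIntegralLevel n E)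
        (π : CuspidalAutomorphicRepData n F hF) (P : CuspidalAutomorphicRepData n E hE),
        IsWeakBaseChangeLiftAE π.1 P.1 →
          ∀ (w : HeightOneSpectrum (𝓞 E)) (v : HeightOneSpectrum (𝓞 F)) (α : Multiset ℂ),
            w.asIdeal.under (𝓞 F) = v.asIdeal → ¬ Algebra.IsUnramifiedIn (𝓞 E) v.asIdeal →
              π.1.HasSatakeParamAt v α → P.1.HasSatakeParamAt w α) :
    ∀ (n : ℕ) (F E : Type) [Field F] [NumberField F] [Field E] [NumberField E] [Algebra F E]
      [IsGalois F E], (Module.finrank F E).Prime →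
      ∀ (hF : Literature.NumberTheory.Automorphic.isCompact_glFiniteIntegralLevel n F)
        (hE : Literature.NumberTheory.Automorphic.isCompact_glFiniteIntegralLevel n E)
        (π : Literature.NumberTheory.Automorphic.CuspidalAutomorphicRepData n F hF)
        (P : Literature.NumberTheory.Automorphic.CuspidalAutomorphicRepData n E hE),
        (∀ᶠ w : IsDedekindDomain.HeightOneSpectrum (NumberField.RingOfIntegers E) in Filter.cofinite,
          ∀ (v : IsDedekindDomain.HeightOneSpectrum (NumberField.RingOfIntegers F)) (α : Multiset ℂ),
            w.asIdeal.under (NumberField.RingOfIntegers F) = v.asIdeal → π.1.HasSatakeParamAt v α →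
              P.1.HasSatakeParamAt w
                (α.map (· ^ w.asIdeal.inertiaDeg (NumberField.RingOfIntegers F)))) →
        ∀ (w : IsDedekindDomain.HeightOneSpectrum (NumberField.RingOfIntegers E))
          (v : IsDedekindDomain.HeightOneSpectrum (NumberField.RingOfIntegers F)) (α : Multiset ℂ),
          w.asIdeal.under (NumberField.RingOfIntegers F) = v.asIdeal → π.1.HasSatakeParamAt v α →
            P.1.HasSatakeParamAt w
              (α.map (· ^ w.asIdeal.inertiaDeg (NumberField.RingOfIntegers F))) :=
  strongLiftingAllFinite_of_unramifiedLift_of_ramified hU hR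

end Summit.Langlands.Langlands.Theorems.SkinnerWilesDefectOne
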